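import Literature.NumberTheory.CubicFields.VoronoiReduction
import Literature.NumberTheory.CubicFields.VoronoiChainRescale
import Literature.NumberTheory.CubicFields.VoronoiChainFilter
import HarnessLib

/-!
# One reduction step along the Voronoi chain (cubic fields of signature (1,1))

Topic `Literature/NumberTheory/CubicFields`; continues `VoronoiReduction.lean` and
`VoronoiChainRescale.lean`. For a cubic number field `K` with a real embedding `σ₁` and a non-real
embedding `σ₂`, a nonzero fractional ideal `I` and the Voronoi chain `θ = voronoiChain σ₁ σ₂ I x₀`
through a positive relative minimum `x₀`, this file isolates the number theory of ONE STEP of the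
Buchmann–Williams walk over the reduced ideals `J i = θ(i)⁻¹ I`:

* `norm_nonneg_iff` — in signature (1,1) the norm has the sign of the real conjugate
  (`N(x) = σ₁ x · ‖σ₂ x‖²`), so sign tests on `σ₁` are exact rational arithmetic;
* `voronoiSucc_one_mem_cylinder` — for a REDUCED ideal `J` (`1` a positive minimum) the Voronoi
  successor of `1` lies in the open unit cylinder `{σ₁ > 0, ‖σ₂‖ < 1}` and has the least real
  conjugate there (so it is the reducing element of the baby step);
* `voronoiChain_cylinder_step` — along the chain: the least element of the unit cylinder of
  `J i` is `θ(i)⁻¹ θ(i+1)`, and dividing by it moves `J i` to `J (i+1)`;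
* `exists_eq_inv_mul_voronoiChain`, `spanSingleton_inv_mul_inv_mul` — the positive minima of
  `c⁻¹ I` (`σ₁ c > 0`) are the `c⁻¹ θ(k)`, and reducing `c⁻¹ I` by one of them lands on `J k`
  (the giant step lands on the chain);
* `bigGap_iff_norm_nonneg` — the big-gap test `11 σ₁θ(i) ≤ 10 σ₁θ(i+1)` is the sign of
  `N(10 θ(i)⁻¹θ(i+1) − 11)`;
* `spanSingleton_inv_unit_mul_mul` — labels are invariant under units: `(u θ)⁻¹ I = θ⁻¹ I`;
* `log_voronoiChain_add_natCast_le`, `log_voronoiChain_le_of_le` — distances along the chain: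
  `0 ≤ log σ₁θ(j) − log σ₁θ(i) ≤ (j − i) log (3√|d_K|)` for `i ≤ j`;
* `absNorm_mul_reduced_bounds`, `log_cylinderMin_bounds` — for the product of two reduced ideals,
  `π²/(4|d_K|) ≤ N ≤ 1`, so its cylinder minimum `γ` has `−log |d_K| ≤ log σ₁ γ ≤ log (3√|d_K|)`.

All statements carry `Module.finrank ℚ K = 3`, `∃ z, conj (σ₂ z) ≠ σ₂ z` and (where the chain is
involved) a unit `ε` with `1 < σ₁ ε` explicitly, as in the previous files. Theorem-only file.

## References

* J. Buchmann, H. C. Williams, *On the infrastructure of the principal ideal class of an algebraic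
  number field of unit rank one*, Math. Comp. 50 (1988), §§2–3. [BuchmannWilliams1988Infrastructure]
* B. N. Delone, D. K. Faddeev, *The theory of irrationalities of the third degree*, Transl. Math.
  Monographs 10, AMS (1964), Ch. IV.
-/

namespace Literature.NumberTheory.CubicFields

open scoped NumberField ComplexConjugate nonZeroDivisors
open NumberField

section Step

variable {K : Type*} [Field K] [NumberField K] {σ₁ : K →+* ℝ} {σ₂ : K →+* ℂ}
  {I : FractionalIdeal (𝓞 K)⁰ K}
variable (hdeg : Module.finrank ℚ K = 3) (hσ₂ : ∃ z : K, starRingEnd ℂ (σ₂ z) ≠ σ₂ z)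

include hdeg hσ₂ in
/-- **Signs are exact**: in signature (1,1), `0 ≤ N(x) ↔ 0 ≤ σ₁ x` (`N(x) = σ₁ x ‖σ₂ x‖²`). [folklore] -/
theorem norm_nonneg_iff (σ₁ : K →+* ℝ) (x : K) : 0 ≤ Algebra.norm ℚ x ↔ 0 ≤ σ₁ x := by
  have hN := norm_eq_mul_norm_sq σ₁ σ₂ hdeg hσ₂ x
  by_cases hx : x = 0
  · subst hx; simp
  · have h2 : 0 < ‖σ₂ x‖ ^ 2 := by
      have : 0 < ‖σ₂ x‖ := norm_pos_iff.mpr ((map_ne_zero σ₂).mpr hx)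
      positivity
    constructor
    · intro h
      have h' : (0 : ℝ) ≤ ((Algebra.norm ℚ x : ℚ) : ℝ) := by exact_mod_cast h
      rw [hN] at h'
      exact nonneg_of_mul_nonneg_left h' h2
    · intro h
      have h' : (0 : ℝ) ≤ σ₁ x * ‖σ₂ x‖ ^ 2 := mul_nonneg h h2.le
      rw [← hN] at h'
      exact_mod_cast h'

variable (ε : (𝓞 K)ˣ) (hε : 1 < σ₁ (algebraMap (𝓞 K) K ε))

include hdeg hσ₂ hε in
/-- **The reducing element of a reduced ideal is the successor of `1`.** If `1` is a positive
relative minimum of `J` then `voronoiSucc J 1` lies in the open unit cylinder `{σ₁ > 0, ‖σ₂‖ < 1}`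
and has the least real conjugate among the elements of `J` in that cylinder (a competitor dominates a
relative minimum `μ` with `‖σ₂ μ‖ < 1 = ‖σ₂ 1‖`, hence `σ₁ μ > σ₁ 1` by the total order of the
minima, hence `σ₁ μ ≥ σ₁ (voronoiSucc J 1)`). [cite: BuchmannWilliams1988Infrastructure, §3] -/
theorem voronoiSucc_one_mem_cylinder {J : FractionalIdeal (𝓞 K)⁰ K} (h1 : (1 : K) ∈ posRelMinima σ₁ σ₂ J) :
    voronoiSucc σ₁ σ₂ J 1 ∈ J ∧ 0 < σ₁ (voronoiSucc σ₁ σ₂ J 1) ∧ ‖σ₂ (voronoiSucc σ₁ σ₂ J 1)‖ < 1 ∧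
      ∀ φ : K, φ ∈ J → 0 < σ₁ φ → ‖σ₂ φ‖ < 1 → σ₁ (voronoiSucc σ₁ σ₂ J 1) ≤ σ₁ φ := by
  obtain ⟨hn, hn1, hn2⟩ := voronoiSucc_spec hdeg hσ₂ ε hε h1
  rw [map_one] at hn1
  have hne : (1 : K) ≠ voronoiSucc σ₁ σ₂ J 1 := fun h => by
    rw [← h, map_one] at hn1; exact lt_irrefl _ hn1
  have hlt : ‖σ₂ (voronoiSucc σ₁ σ₂ J 1)‖ < 1 := by
    have h := (relMinima_lt_iff hdeg hσ₂ h1.1 hn.1 (by rw [map_one]; exact one_pos) hn.2 hne).mp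
      (by rw [map_one]; exact hn1)
    rwa [map_one, norm_one] at h
  refine ⟨hn.1.1, hn.2, hlt, fun φ hφ hφpos hφ1 => ?_⟩
  have hφ0 : φ ≠ 0 := fun h => by rw [h, map_zero] at hφpos; exact lt_irrefl _ hφpos
  obtain ⟨μ, hμ, hμpos, hμ1, hμ2⟩ := exists_mem_relMinima_pos_le hdeg hσ₂ hφ hφ0
  have hμlt : ‖σ₂ μ‖ < ‖σ₂ (1 : K)‖ := by
    rw [map_one, norm_one]; exact lt_of_le_of_lt hμ2 hφ1
  have hne' : (1 : K) ≠ μ := fun h => by rw [← h] at hμlt; exact lt_irrefl _ hμlt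
  have h1μ : σ₁ 1 < σ₁ μ :=
    (relMinima_lt_iff hdeg hσ₂ h1.1 hμ (by rw [map_one]; exact one_pos) hμpos hne').mpr hμlt
  calc σ₁ (voronoiSucc σ₁ σ₂ J 1) ≤ σ₁ μ := hn2 μ ⟨hμ, hμpos⟩ h1μ
    _ ≤ |σ₁ φ| := hμ1
    _ = σ₁ φ := abs_of_pos hφpos

include hdeg hσ₂ hε in
/-- **One baby step along the chain.** With `θ = voronoiChain σ₁ σ₂ I x₀` and `J i = θ(i)⁻¹ I`: the
element `γ = θ(i)⁻¹ θ(i+1)` of `J i` lies in the open unit cylinder, has the least real conjugate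
there, and `γ⁻¹ J i = J (i+1)`. [cite: BuchmannWilliams1988Infrastructure, §3] -/
theorem voronoiChain_cylinder_step {x₀ : K} (hx₀ : x₀ ∈ posRelMinima σ₁ σ₂ I) (i : ℤ) :
    (voronoiChain σ₁ σ₂ I x₀ i)⁻¹ * voronoiChain σ₁ σ₂ I x₀ (i + 1) ∈
        FractionalIdeal.spanSingleton (𝓞 K)⁰ (voronoiChain σ₁ σ₂ I x₀ i)⁻¹ * I ∧
      0 < σ₁ ((voronoiChain σ₁ σ₂ I x₀ i)⁻¹ * voronoiChain σ₁ σ₂ I x₀ (i + 1)) ∧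
      ‖σ₂ ((voronoiChain σ₁ σ₂ I x₀ i)⁻¹ * voronoiChain σ₁ σ₂ I x₀ (i + 1))‖ < 1 ∧
      (∀ φ : K, φ ∈ FractionalIdeal.spanSingleton (𝓞 K)⁰ (voronoiChain σ₁ σ₂ I x₀ i)⁻¹ * I → 0 < σ₁ φ →
        ‖σ₂ φ‖ < 1 → σ₁ ((voronoiChain σ₁ σ₂ I x₀ i)⁻¹ * voronoiChain σ₁ σ₂ I x₀ (i + 1)) ≤ σ₁ φ) ∧
      FractionalIdeal.spanSingleton (𝓞 K)⁰ ((voronoiChain σ₁ σ₂ I x₀ i)⁻¹ * voronoiChain σ₁ σ₂ I x₀ (i + 1))⁻¹ *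
          (FractionalIdeal.spanSingleton (𝓞 K)⁰ (voronoiChain σ₁ σ₂ I x₀ i)⁻¹ * I) =
        FractionalIdeal.spanSingleton (𝓞 K)⁰ (voronoiChain σ₁ σ₂ I x₀ (i + 1))⁻¹ * I := by
  set J := FractionalIdeal.spanSingleton (𝓞 K)⁰ (voronoiChain σ₁ σ₂ I x₀ i)⁻¹ * I with hJ
  have h1 : (1 : K) ∈ posRelMinima σ₁ σ₂ J := one_mem_posRelMinima_inv_mul (voronoiChain_mem hdeg hσ₂ ε hε hx₀ i)
  have hγ : (voronoiChain σ₁ σ₂ I x₀ i)⁻¹ * voronoiChain σ₁ σ₂ I x₀ (i + 1) = voronoiSucc σ₁ σ₂ J 1 := by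
    rw [← voronoiChain_inv_mul hdeg hσ₂ ε hε hx₀ i 1, show (1 : ℤ) = 0 + 1 by ring,
      voronoiChain_succ hdeg hσ₂ ε hε h1, voronoiChain_zero]
  obtain ⟨hm, hpos, hlt, hmin⟩ := voronoiSucc_one_mem_cylinder hdeg hσ₂ ε hε h1
  have h0 : voronoiChain σ₁ σ₂ I x₀ i ≠ 0 := (voronoiChain_mem hdeg hσ₂ ε hε hx₀ i).1.2.1
  have h0' : voronoiChain σ₁ σ₂ I x₀ (i + 1) ≠ 0 := (voronoiChain_mem hdeg hσ₂ ε hε hx₀ (i + 1)).1.2.1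
  refine ⟨hγ ▸ hm, hγ ▸ hpos, hγ ▸ hlt, hγ ▸ hmin, ?_⟩
  rw [hJ, ← mul_assoc, FractionalIdeal.spanSingleton_mul_spanSingleton]
  congr 1
  rw [mul_inv, inv_inv, mul_comm, ← mul_assoc, inv_mul_cancel₀ h0, one_mul]

/-- `c · (c⁻¹ I) = I` for `c ≠ 0`. [folklore] -/
theorem spanSingleton_mul_spanSingleton_inv_mul {c : K} (hc : c ≠ 0) :
    FractionalIdeal.spanSingleton (𝓞 K)⁰ c * (FractionalIdeal.spanSingleton (𝓞 K)⁰ c⁻¹ * I) = I := by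
  rw [← mul_assoc, FractionalIdeal.spanSingleton_mul_spanSingleton, mul_inv_cancel₀ hc,
    FractionalIdeal.spanSingleton_one, one_mul]

include hdeg hσ₂ hε in
/-- **The giant step lands on the chain, I**: every positive relative minimum of `c⁻¹ I`
(`σ₁ c > 0`) is `c⁻¹ θ(k)` for some `k`. [cite: BuchmannWilliams1988Infrastructure, §3] -/
theorem exists_eq_inv_mul_voronoiChain {x₀ c γ : K} (hx₀ : x₀ ∈ posRelMinima σ₁ σ₂ I) (hc : 0 < σ₁ c)
    (hγ : γ ∈ posRelMinima σ₁ σ₂ (FractionalIdeal.spanSingleton (𝓞 K)⁰ c⁻¹ * I)) :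
    ∃ k : ℤ, γ = c⁻¹ * voronoiChain σ₁ σ₂ I x₀ k := by
  have hc0 : c ≠ 0 := (map_ne_zero σ₁).mp hc.ne'
  have h := mul_mem_posRelMinima hc hγ
  rw [spanSingleton_mul_spanSingleton_inv_mul hc0] at h
  obtain ⟨k, hk⟩ := exists_voronoiChain_eq hdeg hσ₂ ε hε hx₀ h
  exact ⟨k, by rw [hk, ← mul_assoc, inv_mul_cancel₀ hc0, one_mul]⟩

/-- **The giant step lands on the chain, II**: reducing `c⁻¹ I` by `γ = c⁻¹ ν` gives `ν⁻¹ I`. [folklore] -/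
theorem spanSingleton_inv_mul_inv_mul {c ν : K} (hc : c ≠ 0) :
    FractionalIdeal.spanSingleton (𝓞 K)⁰ (c⁻¹ * ν)⁻¹ * (FractionalIdeal.spanSingleton (𝓞 K)⁰ c⁻¹ * I) =
      FractionalIdeal.spanSingleton (𝓞 K)⁰ ν⁻¹ * I := by
  rw [← mul_assoc, FractionalIdeal.spanSingleton_mul_spanSingleton]
  congr 1
  rw [mul_inv, inv_inv, mul_comm c, mul_assoc, mul_inv_cancel₀ hc, mul_one]

include hdeg hσ₂ hε in
/-- **The big-gap test is a sign test**: `11 σ₁θ(i) ≤ 10 σ₁θ(i+1)` iff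
`0 ≤ N(10 · θ(i)⁻¹θ(i+1) − 11)`. [folklore] -/
theorem bigGap_iff_norm_nonneg {x₀ : K} (hx₀ : x₀ ∈ posRelMinima σ₁ σ₂ I) (i : ℤ) :
    0 ≤ Algebra.norm ℚ ((10 : K) * ((voronoiChain σ₁ σ₂ I x₀ i)⁻¹ * voronoiChain σ₁ σ₂ I x₀ (i + 1)) - 11) ↔
      11 * σ₁ (voronoiChain σ₁ σ₂ I x₀ i) ≤ 10 * σ₁ (voronoiChain σ₁ σ₂ I x₀ (i + 1)) := by
  have hpos : 0 < σ₁ (voronoiChain σ₁ σ₂ I x₀ i) := (voronoiChain_mem hdeg hσ₂ ε hε hx₀ i).2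
  rw [norm_nonneg_iff hdeg hσ₂ σ₁, map_sub, map_mul, map_mul, map_inv₀, map_ofNat, map_ofNat, sub_nonneg,
    show (10 : ℝ) * ((σ₁ (voronoiChain σ₁ σ₂ I x₀ i))⁻¹ * σ₁ (voronoiChain σ₁ σ₂ I x₀ (i + 1))) =
      10 * σ₁ (voronoiChain σ₁ σ₂ I x₀ (i + 1)) / σ₁ (voronoiChain σ₁ σ₂ I x₀ i) by ring, le_div_iff₀ hpos]

/-- **Labels are unit-invariant**: `(u ν)⁻¹ I = ν⁻¹ I` for a unit `u` of `𝓞 K`. [folklore] -/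
theorem spanSingleton_inv_unit_mul_mul (u : (𝓞 K)ˣ) (ν : K) :
    FractionalIdeal.spanSingleton (𝓞 K)⁰ (algebraMap (𝓞 K) K u * ν)⁻¹ * I =
      FractionalIdeal.spanSingleton (𝓞 K)⁰ ν⁻¹ * I := by
  rw [mul_inv, ← map_units_inv, mul_comm _ ν⁻¹, ← FractionalIdeal.spanSingleton_mul_spanSingleton, mul_assoc,
    spanSingleton_unit_mul]

include hdeg hσ₂ hε in
/-- **Distances increase along the chain**: `log σ₁θ(i) ≤ log σ₁θ(j)` for `i ≤ j`. [folklore] -/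
theorem log_voronoiChain_le_of_le {x₀ : K} (hx₀ : x₀ ∈ posRelMinima σ₁ σ₂ I) {i j : ℤ} (hij : i ≤ j) :
    Real.log (σ₁ (voronoiChain σ₁ σ₂ I x₀ i)) ≤ Real.log (σ₁ (voronoiChain σ₁ σ₂ I x₀ j)) :=
  Real.log_le_log (voronoiChain_mem hdeg hσ₂ ε hε hx₀ i).2 ((voronoiChain_strictMono hdeg hσ₂ ε hε hx₀).monotone hij)

include hdeg hσ₂ hε in
/-- **Distances are bounded along the chain**: `log σ₁θ(i + k) ≤ log σ₁θ(i) + k log (3√|d_K|)`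
(the one-step Minkowski bound `voronoiSucc_le_mul`, iterated). [folklore] -/
theorem log_voronoiChain_add_natCast_le {x₀ : K} (hx₀ : x₀ ∈ posRelMinima σ₁ σ₂ I) (i : ℤ) (k : ℕ) :
    Real.log (σ₁ (voronoiChain σ₁ σ₂ I x₀ (i + k))) ≤
      Real.log (σ₁ (voronoiChain σ₁ σ₂ I x₀ i)) + k * Real.log (3 * Real.sqrt |(discr K : ℝ)|) := by
  have hpos : ∀ j, 0 < σ₁ (voronoiChain σ₁ σ₂ I x₀ j) := fun j => (voronoiChain_mem hdeg hσ₂ ε hε hx₀ j).2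
  have hD : (1 : ℝ) ≤ 3 * Real.sqrt |(discr K : ℝ)| := by
    have h1 : (1 : ℝ) ≤ Real.sqrt |(discr K : ℝ)| := by
      rw [Real.one_le_sqrt]
      have h0 : (1 : ℤ) ≤ |discr K| := Int.one_le_abs (discr_ne_zero K)
      have : ((1 : ℤ) : ℝ) ≤ ((|discr K| : ℤ) : ℝ) := by exact_mod_cast h0
      simpa [Int.cast_abs] using this
    linarith
  have hgap : ∀ j, σ₁ (voronoiChain σ₁ σ₂ I x₀ (j + 1)) ≤
      3 * Real.sqrt |(discr K : ℝ)| * σ₁ (voronoiChain σ₁ σ₂ I x₀ j) := fun j => by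
    rw [voronoiChain_succ hdeg hσ₂ ε hε hx₀]
    exact voronoiSucc_le_mul hdeg hσ₂ ε hε (voronoiChain_mem hdeg hσ₂ ε hε hx₀ j)
  have h := apply_add_le_pow_mul (a := fun j => σ₁ (voronoiChain σ₁ σ₂ I x₀ j)) (by linarith) hgap i k
  have h' := Real.log_le_log (hpos _) h
  rw [Real.log_mul (by positivity) (hpos i).ne', Real.log_pow] at h'
  linarith

include hdeg hσ₂ in
/-- **The norm of a product of two reduced ideals**: `π²/(4|d_K|) ≤ N(J₁ J₂) ≤ 1`. [folklore] -/
theorem absNorm_mul_reduced_bounds {J₁ J₂ : FractionalIdeal (𝓞 K)⁰ K} (h₁ : (1 : K) ∈ posRelMinima σ₁ σ₂ J₁)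
    (h₂ : (1 : K) ∈ posRelMinima σ₁ σ₂ J₂) :
    Real.pi ^ 2 / (4 * |(discr K : ℝ)|) ≤ ((FractionalIdeal.absNorm (J₁ * J₂) : ℚ) : ℝ) ∧
      ((FractionalIdeal.absNorm (J₁ * J₂) : ℚ) : ℝ) ≤ 1 := by
  obtain ⟨-, hle₁, hge₁⟩ := reducedIdeal_bounds hdeg hσ₂ h₁
  obtain ⟨-, hle₂, hge₂⟩ := reducedIdeal_bounds hdeg hσ₂ h₂
  have hd : 0 < |(discr K : ℝ)| := by rw [← Int.cast_abs]; exact_mod_cast abs_pos.mpr (discr_ne_zero K)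
  have hD0 : 0 < Real.sqrt |(discr K : ℝ)| := Real.sqrt_pos.mpr hd
  have hsq : Real.sqrt |(discr K : ℝ)| ^ 2 = |(discr K : ℝ)| := Real.sq_sqrt hd.le
  have h0 : 0 ≤ Real.pi / (2 * Real.sqrt |(discr K : ℝ)|) := by positivity
  rw [map_mul, Rat.cast_mul]
  constructor
  · have h4 : 2 * Real.sqrt |(discr K : ℝ)| * (2 * Real.sqrt |(discr K : ℝ)|) = 4 * |(discr K : ℝ)| := by
      linear_combination 4 * hsq
    calc Real.pi ^ 2 / (4 * |(discr K : ℝ)|) = (Real.pi / (2 * Real.sqrt |(discr K : ℝ)|)) *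
          (Real.pi / (2 * Real.sqrt |(discr K : ℝ)|)) := by
          rw [div_mul_div_comm, h4, sq]
      _ ≤ _ := mul_le_mul hge₁ hge₂ h0 (by exact_mod_cast FractionalIdeal.absNorm_nonneg J₁)
  · calc ((FractionalIdeal.absNorm J₁ : ℚ) : ℝ) * ((FractionalIdeal.absNorm J₂ : ℚ) : ℝ) ≤ 1 * 1 :=
          mul_le_mul hle₁ hle₂ (by exact_mod_cast FractionalIdeal.absNorm_nonneg J₂) zero_le_one
      _ = 1 := one_mul _

include hdeg hσ₂ in
/-- **The reducing element of a giant step is not far**: if `π²/(4|d_K|) ≤ N(M) ≤ 1` and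
`N(M) < σ₁ γ ≤ 3 N(M) √|d_K|` (the cylinder minimum of `M`, `exists_cylinder_min`), then
`−log |d_K| ≤ log σ₁ γ ≤ log (3 √|d_K|)`. [folklore] -/
theorem log_cylinderMin_bounds {M : FractionalIdeal (𝓞 K)⁰ K} {γ : K}
    (hN : Real.pi ^ 2 / (4 * |(discr K : ℝ)|) ≤ ((FractionalIdeal.absNorm M : ℚ) : ℝ))
    (hN1 : ((FractionalIdeal.absNorm M : ℚ) : ℝ) ≤ 1)
    (hlo : ((FractionalIdeal.absNorm M : ℚ) : ℝ) < σ₁ γ)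
    (hhi : σ₁ γ ≤ 3 * ((FractionalIdeal.absNorm M : ℚ) : ℝ) * Real.sqrt |(discr K : ℝ)|) :
    -Real.log |(discr K : ℝ)| ≤ Real.log (σ₁ γ) ∧ Real.log (σ₁ γ) ≤ Real.log (3 * Real.sqrt |(discr K : ℝ)|) ∧
      1 / |(discr K : ℝ)| < σ₁ γ := by
  have _ := hσ₂; have _ := hdeg
  have hd : 0 < |(discr K : ℝ)| := by rw [← Int.cast_abs]; exact_mod_cast abs_pos.mpr (discr_ne_zero K)
  have hD0 : 0 < Real.sqrt |(discr K : ℝ)| := Real.sqrt_pos.mpr hd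
  have hpi : 4 < Real.pi ^ 2 := by nlinarith [Real.pi_gt_three]
  have hinv : 1 / |(discr K : ℝ)| < σ₁ γ := by
    calc 1 / |(discr K : ℝ)| < Real.pi ^ 2 / (4 * |(discr K : ℝ)|) := by
          rw [div_lt_div_iff₀ hd (by positivity)]; nlinarith
      _ ≤ _ := hN
      _ < σ₁ γ := hlo
  have hγ : 0 < σ₁ γ := lt_trans (by positivity) hinv
  refine ⟨?_, ?_, hinv⟩
  · rw [← Real.log_inv, ← one_div]
    exact Real.log_le_log (by positivity) hinv.le
  · refine Real.log_le_log hγ (hhi.trans ?_)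
    calc 3 * ((FractionalIdeal.absNorm M : ℚ) : ℝ) * Real.sqrt |(discr K : ℝ)| ≤ 3 * 1 * Real.sqrt |(discr K : ℝ)| := by
          gcongr
      _ = 3 * Real.sqrt |(discr K : ℝ)| := by ring

include hdeg hσ₂ in
/-- **The least element of the unit cylinder is the cylinder minimum**: an element `γ ∈ I` of the
open unit cylinder with least real conjugate there is a positive relative minimum of `I` with
`N(I) < σ₁ γ ≤ 3 N(I) √|d_K|` (comparison with `exists_cylinder_min`). [folklore] -/
theorem cylinder_least_bounds (hI : I ≠ 0) {γ : K} (hγI : γ ∈ I) (hγpos : 0 < σ₁ γ) (hγ1 : ‖σ₂ γ‖ < 1)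
    (hγmin : ∀ φ : K, φ ∈ I → 0 < σ₁ φ → ‖σ₂ φ‖ < 1 → σ₁ γ ≤ σ₁ φ) :
    γ ∈ posRelMinima σ₁ σ₂ I ∧ ((FractionalIdeal.absNorm I : ℚ) : ℝ) < σ₁ γ ∧
      σ₁ γ ≤ 3 * ((FractionalIdeal.absNorm I : ℚ) : ℝ) * Real.sqrt |(discr K : ℝ)| := by
  obtain ⟨γ', hI', hpos', h1', hmin', -, hrel, hlo, hhi⟩ := exists_cylinder_min hdeg hσ₂ hI
  have h : γ = γ' := σ₁.injective (le_antisymm (hγmin γ' hI' hpos' h1') (hmin' γ hγI hγpos hγ1))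
  subst h
  exact ⟨hrel, hlo, hhi⟩

include hdeg hσ₂ in
/-- **Norm bounds of a reduced ideal**, in the form used for the walk: `π²/(4|d_K|) ≤ N(J) ≤ 1`
(`reducedIdeal_bounds` and `π/(2√|d|) ≥ π²/(4|d|)` as `|d_K| > 2`). [folklore] -/
theorem absNorm_reduced_bounds {J : FractionalIdeal (𝓞 K)⁰ K} (h1 : (1 : K) ∈ posRelMinima σ₁ σ₂ J) :
    Real.pi ^ 2 / (4 * |(discr K : ℝ)|) ≤ ((FractionalIdeal.absNorm J : ℚ) : ℝ) ∧
      ((FractionalIdeal.absNorm J : ℚ) : ℝ) ≤ 1 := by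
  obtain ⟨-, hle, hge⟩ := reducedIdeal_bounds hdeg hσ₂ h1
  have hd2 : 2 < |(discr K : ℝ)| := by
    have h2 := abs_discr_gt_two (K := K) (by rw [hdeg]; norm_num)
    rw [← Int.cast_abs]; exact_mod_cast h2
  have hd : 0 < |(discr K : ℝ)| := by linarith
  have hD0 : 0 < Real.sqrt |(discr K : ℝ)| := Real.sqrt_pos.mpr hd
  have hsq : Real.sqrt |(discr K : ℝ)| ^ 2 = |(discr K : ℝ)| := Real.sq_sqrt hd.le
  refine ⟨le_trans ?_ hge, hle⟩
  -- `π²/(4d) ≤ π/(2√d)` iff `π ≤ 2 √d`, true as `d ≥ 3 > π²/4`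
  have hd3 : 3 ≤ |(discr K : ℝ)| := by
    have h2 := abs_discr_gt_two (K := K) (by rw [hdeg]; norm_num)
    have h3 : (3 : ℤ) ≤ |discr K| := h2
    rw [← Int.cast_abs]; exact_mod_cast h3
  have hpi := Real.pi_lt_d2
  have h2s : Real.pi ≤ 2 * Real.sqrt |(discr K : ℝ)| := by
    by_contra hcon
    push Not at hcon
    have h := pow_lt_pow_left₀ hcon (by positivity) two_ne_zero
    nlinarith
  rw [div_le_div_iff₀ (by positivity) (by positivity)]
  calc Real.pi ^ 2 * (2 * Real.sqrt |(discr K : ℝ)|) = (Real.pi * (2 * Real.sqrt |(discr K : ℝ)|)) * Real.pi := by ring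
    _ ≤ (Real.pi * (2 * Real.sqrt |(discr K : ℝ)|)) * (2 * Real.sqrt |(discr K : ℝ)|) :=
        mul_le_mul_of_nonneg_left h2s (by positivity)
    _ = Real.pi * (4 * Real.sqrt |(discr K : ℝ)| ^ 2) := by ring
    _ = Real.pi * (4 * |(discr K : ℝ)|) := by rw [hsq]

include hdeg hσ₂ hε in
/-- **Labels along the chain are `n₀`-periodic**: if `θ (i + n₀) = u θ i` for a unit `u` then
`θ(i + q n₀)⁻¹ I = θ(i)⁻¹ I` for all `q : ℤ`. [folklore] -/
theorem voronoiChain_label_periodic {x₀ : K} (hx₀ : x₀ ∈ posRelMinima σ₁ σ₂ I) (u : (𝓞 K)ˣ) {n₀ : ℕ}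
    (hper : ∀ i, voronoiChain σ₁ σ₂ I x₀ (i + n₀) = algebraMap (𝓞 K) K u * voronoiChain σ₁ σ₂ I x₀ i)
    (i q : ℤ) :
    FractionalIdeal.spanSingleton (𝓞 K)⁰ (voronoiChain σ₁ σ₂ I x₀ (i + q * n₀))⁻¹ * I =
      FractionalIdeal.spanSingleton (𝓞 K)⁰ (voronoiChain σ₁ σ₂ I x₀ i)⁻¹ * I := by
  have _ := hx₀; have _ := hε; have _ := hdeg; have _ := hσ₂
  induction q using Int.induction_on with
  | zero => simp
  | succ q ih =>
    rw [show i + ((q : ℤ) + 1) * n₀ = (i + q * n₀) + n₀ by ring, hper, spanSingleton_inv_unit_mul_mul, ih]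
  | pred q ih =>
    rw [← ih, show i + (-(q : ℤ)) * n₀ = (i + (-(q : ℤ) - 1) * n₀) + n₀ by ring, hper,
      spanSingleton_inv_unit_mul_mul]

omit [NumberField K] in
/-- **The chain under a one-step period**: `θ (i + q n₀) = u ^ q θ i` for `q : ℤ`. [folklore] -/
theorem voronoiChain_add_int_mul {x₀ u : K} (hu : u ≠ 0) {n₀ : ℕ}
    (hper : ∀ i, voronoiChain σ₁ σ₂ I x₀ (i + n₀) = u * voronoiChain σ₁ σ₂ I x₀ i) (i q : ℤ) :
    voronoiChain σ₁ σ₂ I x₀ (i + q * n₀) = u ^ q * voronoiChain σ₁ σ₂ I x₀ i :=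
  eq_zpow_mul_of_forall_apply_add hu hper i q

omit [NumberField K] in
/-- **The big-gap test is `n₀`-periodic.** [folklore] -/
theorem bigGap_add_int_mul_iff {x₀ u : K} (hu : 0 < σ₁ u) {n₀ : ℕ}
    (hper : ∀ i, voronoiChain σ₁ σ₂ I x₀ (i + n₀) = u * voronoiChain σ₁ σ₂ I x₀ i) (j q : ℤ) :
    11 * σ₁ (voronoiChain σ₁ σ₂ I x₀ (j + q * n₀)) ≤ 10 * σ₁ (voronoiChain σ₁ σ₂ I x₀ (j + q * n₀ + 1)) ↔
      11 * σ₁ (voronoiChain σ₁ σ₂ I x₀ j) ≤ 10 * σ₁ (voronoiChain σ₁ σ₂ I x₀ (j + 1)) := by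
  have hu0 : u ≠ 0 := (map_ne_zero σ₁).mp hu.ne'
  rw [show j + q * n₀ + 1 = (j + 1) + q * n₀ by ring, voronoiChain_add_int_mul hu0 hper,
    voronoiChain_add_int_mul hu0 hper, map_mul, map_mul, map_zpow₀, mul_left_comm (11 : ℝ), mul_left_comm (10 : ℝ)]
  exact mul_le_mul_iff_of_pos_left (zpow_pos hu q)

omit [NumberField K] in
/-- **Distances under a one-step period**: `log σ₁θ(i + q n₀) = log σ₁θ(i) + q log σ₁ u`. [folklore] -/
theorem log_voronoiChain_add_int_mul {x₀ u : K} (hu : 0 < σ₁ u) (hpos : ∀ i, 0 < σ₁ (voronoiChain σ₁ σ₂ I x₀ i))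
    {n₀ : ℕ} (hper : ∀ i, voronoiChain σ₁ σ₂ I x₀ (i + n₀) = u * voronoiChain σ₁ σ₂ I x₀ i) (i q : ℤ) :
    Real.log (σ₁ (voronoiChain σ₁ σ₂ I x₀ (i + q * n₀))) =
      Real.log (σ₁ (voronoiChain σ₁ σ₂ I x₀ i)) + q * Real.log (σ₁ u) := by
  have hu0 : u ≠ 0 := (map_ne_zero σ₁).mp hu.ne'
  rw [voronoiChain_add_int_mul hu0 hper, map_mul, map_zpow₀, Real.log_mul (zpow_pos hu q).ne' (hpos i).ne',
    Real.log_zpow]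
  ring

/-- **Products of labels**: `(x⁻¹ I)(y⁻¹ J) = (x y)⁻¹ (I J)`. [folklore] -/
theorem spanSingleton_inv_mul_mul_spanSingleton_inv_mul (x y : K) (J : FractionalIdeal (𝓞 K)⁰ K) :
    FractionalIdeal.spanSingleton (𝓞 K)⁰ x⁻¹ * I * (FractionalIdeal.spanSingleton (𝓞 K)⁰ y⁻¹ * J) =
      FractionalIdeal.spanSingleton (𝓞 K)⁰ (x * y)⁻¹ * (I * J) := by
  rw [mul_inv, ← FractionalIdeal.spanSingleton_mul_spanSingleton]; ring

omit [NumberField K] in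
/-- **The product of two fractional ideals is the subgroup generated by the products.** [folklore] -/
theorem mem_mul_iff_mem_closure (J : FractionalIdeal (𝓞 K)⁰ K) (φ : K) :
    φ ∈ I * J ↔ φ ∈ AddSubgroup.closure {ψ : K | ∃ ψ₁ ψ₂ : K, ψ₁ ∈ I ∧ ψ₂ ∈ J ∧ ψ = ψ₁ * ψ₂} := by
  constructor
  · intro h
    refine FractionalIdeal.mul_induction_on h (fun x hx y hy => AddSubgroup.subset_closure ⟨x, y, hx, hy, rfl⟩)
      (fun x y hx hy => AddSubgroup.add_mem _ hx hy)
  · intro h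
    induction h using AddSubgroup.closure_induction with
    | mem x hx =>
      obtain ⟨ψ₁, ψ₂, h₁, h₂, rfl⟩ := hx
      exact FractionalIdeal.mul_mem_mul h₁ h₂
    | zero => exact FractionalIdeal.zero_mem _
    | add x y _ _ hx hy =>
      exact FractionalIdeal.mem_coe.mp (Submodule.add_mem _ (FractionalIdeal.mem_coe.mpr hx) (FractionalIdeal.mem_coe.mpr hy))
    | neg x _ hx => exact neg_mem_fractionalIdeal hx

omit [NumberField K] in
/-- **The unit ideal consists of the algebraic integers.** [folklore] -/
theorem mem_one_iff_isIntegral (φ : K) : φ ∈ (1 : FractionalIdeal (𝓞 K)⁰ K) ↔ IsIntegral ℤ φ := by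
  rw [FractionalIdeal.mem_one_iff]
  constructor
  · rintro ⟨x, rfl⟩; exact x.isIntegral_coe
  · intro h; exact ⟨⟨φ, h⟩, rfl⟩

end Step

end Literature.NumberTheory.CubicFields
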